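import Mathlib
import HarnessLib
import Summits.HubbardSuperconductivity.HubbardSuperconductivity.Theorems.KLProgrammeKLRegimeEngineScaleOneBaseRows

/-!
# Route `KLProgramme` — crux K3 ENGINE (stmt-HubbardSuperconductivity-20437 `KLRegimeEngineV17F2`), stub (b) v2, THE LEVELS PACKAGE (ℓ):
# THE LEVEL-`0` DATUM ROWS AS A THEOREM WITH A c-UNIFORM U-DOOR (cell gate-hubbard-kl, seat gate-hubbard-kl-p3 g22; variant of
# `exists_levelZeroBaseRows_klEng` (…ScaleOneBaseRows, p697771) for composition into the ∀-prefix of the (ℓ) assembly)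

`exists_levelZeroBaseRows_klEng` states its U-door as `∀ c ≤ c₀, ∃ U₀ > 0, ∀ U ≤ U₀` with `U₀ = min (klEngU₀6 P R c) (explicit R-constant)`.  Since the assembly's
prefix already carries `U ≤ klEngU₀9 P R c ≤ klEngU₀6 P R c` (`klEngU₀9_le_klEngU₀6`), the c-dependence can be moved into that binder and the remaining door is ONE
c-free constant:

* **`exists_levelZeroBaseRows_klEng_unif (P R)`** — `∃ A₁ P₁ > 0, ∃ c₀ > 0, ∃ U₀ > 0, ∀ c, 0 < c ≤ c₀ → ∀ μ ∈ klWindowC, ∀ U, 0 < U → U ≤ klEngU₀9 P R c → U ≤ U₀ → …`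
  (same body: the regime, every volume above `(klEngL₃, klEngM₃)`, every `FrameOK` frame ⇒ `∃ Nb ≥ 0` dominating the levelled norms of `𝒱_1` at `F_0` with the unit law
  `Nb t p / klLevUnitF β M t p 0 ≤ (A₁·ε_x/Klam²/B²)·(B·ε_j)^{p−1}·(P₁/ε_x²)^p`, `p ≥ 3`, every `B ≥ 1`, every `j`).  Proof = p697771's §2 proof verbatim with the two door
  lines changed.
Composition of landed theorems and real algebra; nothing about the model is asserted beyond them; nothing asserts (ℓ), any stub, K3 or superconductivity.
References: BGM 2006 §2.7 (2.77)–(2.81), §2.8 (2.83), (2.93)–(2.98) [cite: BenfattoGiulianiMastropietro2006].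
-/

noncomputable section

namespace Summit.HubbardSuperconductivity.HubbardSuperconductivity.Theorems.EngineV8

set_option linter.dupNamespace false -- summit = problem name (single-conjunct summit), D-0017

open Real Finset Complex Literature.MathematicalPhysics.QuantumLattice Literature.Probability.LatticeModels Literature.Probability.LatticeModels.BattleFederbush Literature.MathematicalPhysics.QuantumLattice.GrassmannAlgebra
open Summit.HubbardSuperconductivity.HubbardSuperconductivity.Theorems.KLRegimeSplit Summit.HubbardSuperconductivity.HubbardSuperconductivity.Theorems.DispersionFlow
open Summit.HubbardSuperconductivity.HubbardSuperconductivity.Theorems.KLProgrammeLegKernels Summit.HubbardSuperconductivity.HubbardSuperconductivity.Theorems.ScaleZeroDecay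
open scoped ComplexConjugate

variable {L M : ℕ}

/-! ## The level-`0` base rows, c-uniform U-door -/

set_option maxHeartbeats 400000 in -- the door bookkeeping + the bi-graded budget algebra
/-- **THE LEVEL-`0` DATUM ROWS OF (α′), AS A THEOREM, c-UNIFORM U-DOOR** (variant of `exists_levelZeroBaseRows_klEng`: `∃ U₀` BEFORE `∀ c`, plus `U ≤ klEngU₀9 P R c`) — for every well-formed `P R` there are `A₁, P₁ > 0` and doors `c₀`, `U₀` such that in the regime, at every
volume above `(klEngL₃, klEngM₃)` and for EVERY admissible frame `K` (`FrameOK R U (nScales β) μ K`), an array `Nb : Fin 5 → ℕ → ℝ` exists with: `Nb ≥ 0`;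
every levelled norm of `𝒱_1 = klTowerInput … 1 1` at `F_0` of level `t + 1` in degree `2p` is `≤ Nb t p`; and for every `B ≥ 1`, every `j` and every `p ≥ 3`,
`Nb t p / klLevUnitF β M t p 0 ≤ (A₁·ε_x/Klam²/B²)·(B·ε_j)^{p−1}·(P₁/ε_x²)^p` (`ε_x = imagTimeWeight β M`) — the `Nb/hcar/hlawb` binders of
`kernelNormsLevels_blockZeroF_klEng` and of the assembly of record. [cite: BenfattoGiulianiMastropietro2006, §2.7 (2.77)–(2.81), §2.8 (2.83), (2.93)–(2.98)] -/
theorem exists_levelZeroBaseRows_klEng_unif (P : SplitConsts) (R : RenConsts) (hP : P.WF) (hR : R.WF2) :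
    ∃ A₁ P₁ : ℝ, 0 < A₁ ∧ 0 < P₁ ∧ ∃ c₀ : ℝ, 0 < c₀ ∧ ∃ U₀ : ℝ, 0 < U₀ ∧ ∀ c : ℝ, 0 < c → c ≤ c₀ →
      ∀ μ ∈ klWindowC, ∀ U : ℝ, 0 < U → U ≤ klEngU₀9 P R c → U ≤ U₀ → ∀ β : ℝ, klBetaMin ≤ β → β ≤ Real.exp (c / U ^ 2) →
        ∀ (L M : ℕ) [NeZero L] [NeZero M], klEngL₃ β U ≤ L → klEngM₃ β U L ≤ M →
          ∀ K : TrigPolyC4v, FrameOK R U (nScales β) μ K →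
            ∃ Nb : Fin 5 → ℕ → ℝ, (∀ t p, 0 ≤ Nb t p) ∧
              (∀ (t : Fin 5) (p : ℕ) (Ωe' : Fin (2 * p) → Option (SectorLeg (sectorCount 0))), levelCount Ωe' = (t : ℕ) + 1 →
                klLevNormOf L M β μ K 0 (2 * p) (klTowerInput L M β U μ K 1 1) Ωe' ≤ Nb t p) ∧
              ∀ (B : ℝ), 1 ≤ B → ∀ (j : ℕ) (t : Fin 5) (p : ℕ), 3 ≤ p →
                Nb t p / klLevUnitF β M t p 0 ≤
                  (A₁ * imagTimeWeight β M / P.Klam ^ 2 / B ^ 2) * (B * epsCoupling P U j) ^ (p - 1) * (P₁ / imagTimeWeight β M ^ 2) ^ p := by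
  obtain ⟨C_T, hCT0, hCT⟩ := exists_timeMomentConst_klAnisoFamily_zero
  obtain ⟨D₁, hD₁, hbr⟩ := exists_abarOne_le
  have hRwf : R.WF := hR.wf
  have hG : ∀ j, 0 ≤ R.Gfr j := hRwf.2.2
  have hX0 : 0 ≤ klE4X0 := uvSpaceMomentConst_nonneg _ _ _
  have he1 : 1 ≤ Real.exp 1 := Real.one_le_exp (by norm_num)
  have he0 : 0 < Real.exp 1 := Real.exp_pos 1
  have h4 : 0 < Real.log 4 := Real.log_pos (by norm_num)
  have hKF := one_le_klE4KapF R
  have hK1 : 1 ≤ P.Klam := hP.1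
  have hK0 : 0 < P.Klam := lt_of_lt_of_le one_pos hK1
  -- the R-keyed bracket majorant `Ā := D₁·(1 + ΣGfr)⁴ ≥ 1`
  set g : ℝ := (1 + R.Gfr 0 + R.Gfr 1 + R.Gfr 2 + R.Gfr 3) ^ 4 with hg
  have hg1 : 1 ≤ g := by
    rw [hg]
    have : (1 : ℝ) ≤ 1 + R.Gfr 0 + R.Gfr 1 + R.Gfr 2 + R.Gfr 3 := by linarith [hG 0, hG 1, hG 2, hG 3]
    exact one_le_pow₀ this
  set Abar : ℝ := D₁ * g with hAbarD
  have hAbar1 : 1 ≤ Abar := one_le_mul_of_one_le_of_one_le hD₁ hg1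
  have hAbarpos : 0 < Abar := lt_of_lt_of_le one_pos hAbar1
  have hAbar0 : 0 ≤ Abar := hAbarpos.le
  set κ₁ : ℝ := Real.sqrt (2 * (7 + 6047)) + Real.sqrt 6047 with hκ₁
  have hκ₁1 : 1 ≤ κ₁ ^ 2 := by
    have h1 : (1 : ℝ) ≤ Real.sqrt (2 * (7 + 6047)) := by
      rw [show (1 : ℝ) = Real.sqrt 1 by simp]; exact Real.sqrt_le_sqrt (by norm_num)
    have h2 : 0 ≤ Real.sqrt 6047 := Real.sqrt_nonneg _
    have h3 : (1 : ℝ) ≤ κ₁ := by rw [hκ₁]; linarith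
    exact one_le_pow₀ h3
  have hκ₁pos : 0 < κ₁ := by
    rw [hκ₁]; exact add_pos_of_pos_of_nonneg (Real.sqrt_pos.2 (by norm_num)) (Real.sqrt_nonneg _)
  have hKFpos : 0 < klE4KapF R := lt_of_lt_of_le one_pos hKF
  have hMom1 : 0 < klE4Mom R + 1 := by have := klE4Mom_nonneg R; linarith
  set t : ℝ := 2 * klIsoT + C_T + 8 * (klE4X0 + 1) with ht
  have ht0 : 0 < t := by have := klIsoT_nonneg; rw [ht]; positivity
  -- the bi-graded constants of the budget
  set A₁ : ℝ := 4 * Real.exp 1 ^ 9 * κ₁ ^ 4 / (16 * Real.exp 1 ^ 9 * κ₁ ^ 2 * Abar) ^ 2 with hA₁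
  set P₁ : ℝ := 2 * (κ₁⁻¹) ^ 2 * t ^ 2 * (16 * Real.exp 1 ^ 9 * κ₁ ^ 2 * Abar) with hP₁
  have hA₁0 : 0 < A₁ := by rw [hA₁]; positivity
  have hP₁0 : 0 < P₁ := by rw [hP₁]; positivity
  refine ⟨A₁, P₁, hA₁0, hP₁0, ?_⟩
  -- the c-door
  set c₀ : ℝ := min (klEngC₃6 P R) (Real.log 4 / (128 * Real.exp 1 ^ 5 * Abar * (klE4Mom R + 1))) with hc₀
  refine ⟨c₀, lt_min (klEngC₃6_pos P R) (by positivity), 1 / (128 * Real.exp 1 ^ 9 * κ₁ ^ 2 * Abar * klE4KapF R), by positivity,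
    fun c hc hcc₀ => ?_⟩
  have hc₆ : c ≤ klEngC₃6 P R := hcc₀.trans (min_le_left _ _)
  have hcd' : c ≤ Real.log 4 / (128 * Real.exp 1 ^ 5 * Abar * (klE4Mom R + 1)) := hcc₀.trans (min_le_right _ _)
  have hcd : 128 * Real.exp 1 ^ 5 * Abar * (klE4Mom R + 1) * (c / Real.log 4) ≤ 1 := by
    have hden : 0 < 128 * Real.exp 1 ^ 5 * Abar * (klE4Mom R + 1) := by positivity
    rw [le_div_iff₀ hden] at hcd'
    rw [show 128 * Real.exp 1 ^ 5 * Abar * (klE4Mom R + 1) * (c / Real.log 4) =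
      128 * Real.exp 1 ^ 5 * Abar * (klE4Mom R + 1) * c / Real.log 4 by ring, div_le_one h4]
    linarith
  -- the U-door
  intro μ hμ U hU hU9 hUd' β hβ hβc L M _ _ hL hM K hK
  have hU₆ : U ≤ klEngU₀6 P R c := hU9.trans (klEngU₀9_le_klEngU₀6 P R c)
  have hUd : 128 * Real.exp 1 ^ 9 * κ₁ ^ 2 * Abar * klE4KapF R * U ≤ 1 := by
    have hden : 0 < 128 * Real.exp 1 ^ 9 * κ₁ ^ 2 * Abar * klE4KapF R := by positivity
    rw [le_div_iff₀ hden] at hUd'; linarith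
  obtain ⟨hθ1, hθ2⟩ := thetaW_smallness_of_le (cl := c / Real.log 4) he1 hκ₁1 hAbar0 hKF hU (div_nonneg hc.le h4.le) hUd hcd
  have hU₀3 : U ≤ klEngU₀3 P R c := hU₆.trans (klEngU₀6_le_klEngU₀3 P R c)
  have hU1 : |U| ≤ 1 := abs_le_one_of_le_klEngU₀3 hU hU₀3
  have hcD : c ≤ klE4C₃ R := hc₆.trans (klEngC₃6_le_klE4C₃ P R)
  have hNsc := nScales_succ_mul_sq_le (U := U) hc.le hβ hβc
  have hhalf := div_log_four_le_half_of_door hcD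
  have hAbar := (hbr R U (nScales β) hRwf hU1 (hNsc.trans hhalf)).trans (le_of_eq hAbarD.symm)
  have hβ0 : 0 < β := beta_pos_of_klBetaMin_le hβ
  have hε : 0 < imagTimeWeight β M := by
    unfold imagTimeWeight
    have : (0 : ℝ) < M := Nat.cast_pos.2 (Nat.pos_of_ne_zero (NeZero.ne M))
    positivity
  -- the budget: degree 2, the bi-graded closed form `A₁·P₁^p·|U|^{p−1}` in degrees `2p ≥ 4`, `0` elsewhere
  set kK : ℝ := klE4KapF R * |U| + 2 * (c / Real.log 4) * klE4Mom R with hkK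
  have hkK0 : 0 ≤ kK := by rw [hkK]; have := klE4Mom_nonneg R; positivity
  set Nw : ℕ → ℝ := fun p => if p = 1 then 2 * t ^ 2 * (Real.exp 1 ^ 5 * kK + 4 * Real.exp 1 ^ 9 * κ₁ ^ 2 * |U|)
    else if 2 ≤ p then A₁ * P₁ ^ p * |U| ^ (p - 1) else 0 with hNw
  have hNw0 : ∀ p, 0 ≤ Nw p := by
    intro p
    simp only [hNw]
    split_ifs
    · positivity
    · positivity
    · exact le_rfl
  set N : ℕ → ℝ := fun m => if Even m then Nw (m / 2) else 0 with hN
  have hNodd : ∀ m, Odd m → 0 ≤ N m := fun m hm => by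
    simp only [hN, Nat.not_even_iff_odd.2 hm, if_false]; exact le_rfl
  have hNeven : ∀ p, N (2 * p) = Nw p := fun p => by
    simp only [hN, even_two_mul, if_true, Nat.mul_div_cancel_left p two_pos]
  have hN2 : 2 * (2 * klIsoT + C_T + 8 * (klE4X0 + 1)) ^ 2 * (Real.exp 1 ^ 5 * (klE4KapF R * |U| + 2 * (c / Real.log 4) * klE4Mom R) +
      4 * Real.exp 1 ^ 9 * (Real.sqrt (2 * (7 + 6047)) + Real.sqrt 6047) ^ 2 * |U|) ≤ N 2 := by
    have h21 : N 2 = Nw 1 := hNeven 1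
    have hNw1 : Nw 1 = 2 * t ^ 2 * (Real.exp 1 ^ 5 * kK + 4 * Real.exp 1 ^ 9 * κ₁ ^ 2 * |U|) := by simp [hNw]
    rw [h21, hNw1, ht, hkK, hκ₁]
  -- the literal budget of degree `2p ≥ 4` IS `A₁·P₁^p·|U|^{p−1}`
  have hlit : ∀ p, 2 ≤ p → 2 ^ p * (4 * Real.exp 1 ^ 9 * (Real.sqrt (2 * (7 + 6047)) + Real.sqrt 6047) ^ 4 *
      ((Real.sqrt (2 * (7 + 6047)) + Real.sqrt 6047))⁻¹ ^ (2 * p) * (2 * klIsoT + C_T + 8 * (klE4X0 + 1)) ^ (2 * p) *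
        (16 * Real.exp 1 ^ 9 * (Real.sqrt (2 * (7 + 6047)) + Real.sqrt 6047) ^ 2 * Abar * |U|) ^ (p - 2) * |U|) = A₁ * P₁ ^ p * |U| ^ (p - 1) := by
    intro p hp
    obtain ⟨p', rfl⟩ : ∃ p', p = p' + 2 := ⟨p - 2, by omega⟩
    rw [← hκ₁, ← ht, Nat.add_sub_cancel, show p' + 2 - 1 = p' + 1 by omega]
    set W : ℝ := 16 * Real.exp 1 ^ 9 * κ₁ ^ 2 * Abar with hWdef
    have hW0 : 0 < W := by rw [hWdef]; positivity
    have hAW2 : A₁ * W ^ 2 = 4 * Real.exp 1 ^ 9 * κ₁ ^ 4 := by rw [hA₁]; field_simp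
    rw [hP₁, mul_pow (2 * κ₁⁻¹ ^ 2 * t ^ 2) W (p' + 2), mul_pow (2 * κ₁⁻¹ ^ 2) (t ^ 2) (p' + 2), mul_pow (2 : ℝ) (κ₁⁻¹ ^ 2) (p' + 2),
      ← pow_mul κ₁⁻¹ 2 (p' + 2), ← pow_mul t 2 (p' + 2), mul_pow W |U| p', pow_succ |U| p', pow_add W p' 2]
    clear_value W A₁ P₁ κ₁ t Abar kK Nw N
    generalize (2 : ℝ) ^ (p' + 2) = n2
    generalize κ₁⁻¹ ^ (2 * (p' + 2)) = a
    generalize t ^ (2 * (p' + 2)) = b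
    generalize W ^ p' = w
    generalize |U| ^ p' = u
    linear_combination (-(n2 * a * b * w * u * |U|)) * hAW2
  have hNp : ∀ p, 2 ≤ p → 2 ^ p * (4 * Real.exp 1 ^ 9 * (Real.sqrt (2 * (7 + 6047)) + Real.sqrt 6047) ^ 4 *
      ((Real.sqrt (2 * (7 + 6047)) + Real.sqrt 6047))⁻¹ ^ (2 * p) * (2 * klIsoT + C_T + 8 * (klE4X0 + 1)) ^ (2 * p) *
        (16 * Real.exp 1 ^ 9 * (Real.sqrt (2 * (7 + 6047)) + Real.sqrt 6047) ^ 2 * Abar * |U|) ^ (p - 2) * |U|) ≤ N (2 * p) := by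
    intro p hp
    rw [hlit p hp, hNeven p]
    simp only [hNw, show p ≠ 1 by omega, if_false, hp, if_true]
    exact le_rfl
  -- F7 under the doors: every weighted pinned sum of `𝒱_1[K]` at `(F_0, rate 0)` is within the budget
  have hfull := kernelNormsWtAt_one_of_doors hCT0 hCT P R c hP hR hc hc₆ μ hμ U hU hU₆ β hβ hβc K hK L M hL hM hAbar hθ1 hθ2 N hNodd hN2 hNp
  have hgrid : ∀ p, 1 ≤ p → ∀ (q : Fin (2 * p)) (w : SpaceTimeIdx L M × SectorLeg (sectorCount (1 - 1))),
      klWtPinnedSumAt L M β μ K (1 - 1) 0 (2 * p) (klTowerInput L M β U μ K 1 1) q w ≤ Nw p := by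
    intro p _ q w
    rw [← hNeven p]
    unfold klTowerInput
    exact hfull (2 * p) q w
  -- the bi-graded reading with `Ag := A₁·ε_x`, `Pg := P₁/ε_x²`
  have hbi : ∀ p, 3 ≤ p → Nw p ≤ imagTimeWeight β M ^ (2 * p - 1) * (A₁ * imagTimeWeight β M) * (P₁ / imagTimeWeight β M ^ 2) ^ p * |U| ^ (p - 1) := by
    intro p hp
    have hval : Nw p = A₁ * P₁ ^ p * |U| ^ (p - 1) := by
      simp only [hNw, show p ≠ 1 by omega, if_false, show 2 ≤ p by omega, if_true]
    rw [hval]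
    apply le_of_eq
    obtain ⟨p', rfl⟩ : ∃ p', p = p' + 1 := ⟨p - 1, by omega⟩
    have hεne : imagTimeWeight β M ≠ 0 := hε.ne'
    rw [show 2 * (p' + 1) - 1 = 2 * p' + 1 by omega, div_pow, ← pow_mul, Nat.add_sub_cancel]
    clear_value A₁ P₁ κ₁ t Abar kK Nw N
    generalize imagTimeWeight β M = ε at hεne ⊢
    generalize |U| ^ p' = u
    generalize P₁ ^ (p' + 1) = q
    field_simp
    ring
  -- the base rows at `d := 1`: nonnegativity and `hcar` once, the unit law for every `B ≥ 1`, `j`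
  have hBK1 : 1 ≤ (1 : ℝ) * P.Klam := by rw [one_mul]; exact hK1
  have hle1 : 1 * P.Klam * |U| ≤ 1 * epsCoupling P U 0 := by
    rw [one_mul, one_mul]; unfold epsCoupling
    exact mul_le_mul_of_nonneg_left (le_add_of_nonneg_right (by positivity)) hK0.le
  obtain ⟨hNb0, hcar, -⟩ := baseRowsF_of_wgrid_bigraded (L := L) (M := M) hβ0 U μ K 1 0 Nw hNw0 hgrid (by positivity : 0 ≤ A₁ * imagTimeWeight β M)
    (by positivity : 0 ≤ P₁ / imagTimeWeight β M ^ 2) hbi hK0 hBK1 hle1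
  refine ⟨fun _ p => Nw p, hNb0, hcar, fun B hB j t p hp => ?_⟩
  have hB0 : 0 < B := lt_of_lt_of_le one_pos hB
  have hBK : 1 ≤ B * P.Klam := one_le_mul_of_one_le_of_one_le hB hK1
  have hle : B * P.Klam * |U| ≤ B * epsCoupling P U j := by
    unfold epsCoupling
    have h1 : |U| ≤ |U| + U ^ 2 * (j : ℝ) := le_add_of_nonneg_right (by positivity)
    calc B * P.Klam * |U| = B * (P.Klam * |U|) := by ring
      _ ≤ B * (P.Klam * (|U| + U ^ 2 * (j : ℝ))) := mul_le_mul_of_nonneg_left (mul_le_mul_of_nonneg_left h1 hK0.le) hB0.le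
  obtain ⟨-, -, hlawb⟩ := baseRowsF_of_wgrid_bigraded (L := L) (M := M) hβ0 U μ K 1 0 Nw hNw0 hgrid (by positivity : 0 ≤ A₁ * imagTimeWeight β M)
    (by positivity : 0 ≤ P₁ / imagTimeWeight β M ^ 2) hbi hK0 hBK hle
  have h := hlawb t p hp
  simp only [Nat.sub_self, Nat.mul_zero, pow_zero, one_mul, div_one] at h
  exact h

end Summit.HubbardSuperconductivity.HubbardSuperconductivity.Theorems.EngineV8

end
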